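import Literature.MathematicalPhysics.QuantumFieldTheory.Balaban1983to89.B9Eq319QprimeLipschitz

/-!
# `Balaban1983to89.B9Eq319QprimeLipschitzTwoBackgrounds` — T. Bałaban, *Propagators for lattice gauge theories in a background field*, Commun.
# Math. Phys. **99** (1985) 389–434 [Balaban1985BackgroundPropagators] (3.19) p. 393 with (3.65) p. 403 and (3.79)–(3.81) p. 406; [Balaban1985Averaging]
# (9) p. 18: THE ONE-STEP AVERAGING `Q′(U)` OF GAUGE PARAMETERS IS LIPSCHITZ IN THE BACKGROUND BETWEEN TWO GENERAL BACKGROUNDS —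
# `‖Q′(R)λ − Q′(R′)λ‖_∞ ≤ d(L−1)·δ·(1 + ε)^{d(L−1)}·‖λ‖_∞` for two transporter families `ε`-close to the identity and `δ`-close TO EACH OTHER

statement-level skeleton of published theorems with citation tags; proofs where landed; nothing here is a claim
about the Yang–Mills mass gap

PDF held: `paper:balaban1985-cmp99-background-propagators` (journal page = PDF page + 388); (3.19), (3.65), (3.79)–(3.81) through the verbatim
quotations of `B9Eq319QprimeLipschitz` (NE9 leaf-03 gen 57), whose architecture this file mirrors theorem by theorem.

CITATION HEADER (lean-in-tree rule 2026-08-18).  Audit cell `pub-balaban`, sub-cell `t4`, NE9 crux team (2): LEAF PROVER 04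
(`b2b-balaban-t4-ne9-formalise-leaf-04` gen 73), question Q-leaf04-g73-1 to the (ρ′) author lineage `ne9-formalise-leaf-03` (journal
`CLAIMS.log` l.43044; first refusal theirs) — the TWO-BACKGROUND twin of (ρ′) `B9Eq319QprimeLipschitz` (flat base point), item (i) of the NE9
owner's census (journal l.42142: «two-general-fields Lipschitz needs two-background twins of (B)∕(ρ′)∕(δ_Q)»), the (ρ′) third; companion of
this lineage's `B9Eq379QLipschitzGeneral` ((δ_Q)) and `B9Eq373DerivativeRemainderTwoBackgrounds` ((B)).

THE PRINT (verbatim, as quoted in `B9Eq319QprimeLipschitz`).  [B9] (3.19) p. 393: *«(Q′(V)λ)(y) = Σ_{x∈B(y)} L^{−d}R(V(Γ_{y,x}))λ(x)»*; p. 403,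
(3.65): *«Q′(U′U)G′²(U′U)Q′*(U′U) = Q′(U)G′²(U)Q′*(U) + F′₂(A)G′²(U′U)Q′*(U) + Q′(U)G′²(U′U)F′₂*(A) + …»* — print's perturbation `F′₂(A)` of
`Q′` between the GENERAL background `U` and `U′U`, `U′ = e^{iηA}`; [B7] (9) p. 18: *«U(Γ) = Π U(x_i, x_{i+1}), where the order of factors in the
product is the same as the order of bonds in Γ.»*

WHY THIS FILE (cell context).  (ρ′) compares `Q′(R)` with the FLAT `Q′(1)`; a chart of the NE9 chain Lipschitz between TWO GENERAL small-bond
backgrounds needs `‖Q′(U)λ − Q′(U′)λ‖_∞ ≤ ρ′(U,U′)‖λ‖_∞` with `ρ′ → 0` as `U → U′`.  Mechanism: telescoping along the contour as in (ρ′) §1, now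
with TWO transporter families — `τ(b)w − τ′(b)w′ = (τ(b) − τ′(b))w + τ′(b)(w − w′)` bond after bond.

WHAT IS PROVED (sorry-free; no definition; [folklore] finite-lattice bookkeeping on the (ρ′) file's objects).
* §1 `norm_pathTr_cons_le` (`‖R(Γ)v‖ ≤ (1 + ε)^{|Γ|}‖v‖`), **`norm_pathTr_cons_sub_pathTr_le`** — TWO-FAMILY TELESCOPING: step transporters
  `ε`-close to the identity and `δ`-close to each other give `‖R(Γ)v − R′(Γ)v‖ ≤ |Γ|·δ·(1 + ε)^{|Γ|}·‖v‖`.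
* §2 `norm_stepTransport_sub_stepTransport_le`; **`norm_QprimeLin_sub_QprimeLin_apply_le`** (pointwise block form, modulus
  `ρ′₂(ε, δ) := d(L−1)·δ·(1 + ε)^{d(L−1)}`), **`norm_QprimeLin_sub_QprimeLin_le`** (sup form), **`sum_norm_sq_QprimeLin_sub_QprimeLin_le`**
  (Hilbert currency, by the (ρ′) file's block Jensen and block partition).
* §3 **`norm_QprimeW_sub_QprimeW_le`** ∕ `_L2` ∕ **`sum_norm_sq_QprimeW_sub_QprimeW_le`** — the same for the owner's `QprimeW L m φ U` against
  `QprimeW L m φ U′` under the fibre letters `‖R(U(b))w − w‖, ‖R(U′(b))w − w‖ ≤ ε‖w‖`, `‖R(U(b))w − R(U′(b))w‖ ≤ δ‖w‖`.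
* §4 `norm_conj_sub_conj_le_of_mem_U1` (`‖UXU⁻¹ − U′XU′⁻¹‖ ≤ 2‖U − U′‖·‖X‖` on `U1`), **`norm_QprimeAd_sub_QprimeAd_le_of_mem_U1`** — the printed
  instance on `𝔸`-valued gauge parameters at two `U1`-valued backgrounds: `‖U(b) − 1‖, ‖U′(b) − 1‖ ≤ ε_U`, `‖U(b) − U′(b)‖ ≤ δ_U` ⇒
  `‖Q′(U)λ − Q′(U′)λ‖_∞ ≤ d(L−1)·2δ_U·(1 + 2ε_U)^{d(L−1)}·‖λ‖_∞`.
MODEL / DECLARED READINGS.  (M1)–(M3) as `B9Eq319QprimeLipschitz`: one averaging step on the torus, sup norms = `Pi` norms, the `L²` norm (3.11)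
only through `pi_norm_le_WL2_norm`; the closeness letters `ε`, `δ` DISPLAYED; finite-lattice modulus depending on `d`, `L`, `ε`, `δ` only, no
uniformity statement of (3.85)–(3.86) type.  (M4) at `R′ = 1` (`δ = ε`) §2 gives `d(L−1)·ε·(1+ε)^{d(L−1)}` = the (ρ′) file's linear MAJORANT
`rho_le` of its sharper `(1 + ε)^{d(L−1)} − 1` — the flat twin stays the better letter there.
HONEST SCOPE.  [folklore] telescoping; one displayed letter of a two-general-backgrounds chart of the NE9 chain, NOT that chart, NOT [B9] Thm 3.11,
NOT NE9; NOT summit progress (cell pub-balaban: NE9 NOT PRINTED ∕ NOT PROVED; «NE9 ⇐ the named binders»; spine PROVED 0∕9; rung (B)+1 on a finite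
T⁴ — NOT infinite volume, NOT mass gap, NOT Clay).  NEW file importing `B9Eq319QprimeLipschitz` only (its `norm_pathTr_cons_sub_le`,
`length_contour_le`, `norm_stepTransport_sub_le`, `blockMean_norm_le`, `blockMean_norm_sq_le`, `sum_blockOf_sum`, `pi_norm_le_WL2_norm` REUSED BY
NAME); nothing of the leaf-03 ∕ NE9-owner lineages' files is modified.  Net new unproved facts: 0.
-/

noncomputable section
open scoped BigOperators
namespace Literature.MathematicalPhysics.QuantumFieldTheory.Balaban1983to89.B9Eq319QprimeLipschitzTwoBackgrounds

open B4Sect5Torus (TSite)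
open B9SectCLatticeCarrier (Bond shift)
open B9Eq323Ker (avgQ pathTr)
open B9Eq319QprimeTorus (fineP centre contour offset offset_lt length_contour stepTransport weight Qprime QprimeLin QprimeLin_apply QprimeAd)
open B9Eq33CovDerivVector (adTransport adTransport_apply)
open B9Eq310HessianOperator (adTransportW)
open B9Eq326OperatorAssembly (QprimeW)
open B9Eq311L2Pairing (WL2)
open B11Eq103H1Complex (SiteL2K)
open B5Eq172FlatCoercivity (card_blockOf)
open B9Eq319QprimeLipschitz (norm_pathTr_cons_sub_le length_contour_le norm_stepTransport_sub_le blockMean_norm_le blockMean_norm_sq_le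
  sum_blockOf_sum pi_norm_le_WL2_norm)

variable {d : ℕ}
/-! ## §1 Two-family telescoping along a path -/
section PathTransport

variable {X : Type*} {V : Type*} [NormedAddCommGroup V] [NormedSpace ℝ V]

/-- `‖R(Γ)v‖ ≤ (1 + ε)^{|Γ|}‖v‖` for step transporters `ε`-close to the identity (from the (ρ′) file's telescoping `‖R(Γ)v − v‖ ≤ ((1+ε)^{|Γ|} − 1)‖v‖`).
[cite: Balaban1985Averaging, (9) p.18] -/
theorem norm_pathTr_cons_le {τ : X → X → V →ₗ[ℝ] V} {ε : ℝ} (hε : 0 ≤ ε) (hτ : ∀ x x' v, ‖τ x x' v - v‖ ≤ ε * ‖v‖)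
    (p : List X) (x : X) (v : V) : ‖pathTr τ (x :: p) v‖ ≤ (1 + ε) ^ p.length * ‖v‖ := by
  have h := norm_pathTr_cons_sub_le hε hτ p x v
  calc ‖pathTr τ (x :: p) v‖ = ‖(pathTr τ (x :: p) v - v) + v‖ := by rw [sub_add_cancel]
    _ ≤ ‖pathTr τ (x :: p) v - v‖ + ‖v‖ := norm_add_le _ _
    _ ≤ ((1 + ε) ^ p.length - 1) * ‖v‖ + ‖v‖ := by gcongr
    _ = (1 + ε) ^ p.length * ‖v‖ := by ring

/-- **TWO-FAMILY TELESCOPING** ([B7] (9)): if the step transporters `τ`, `τ′` are both `ε`-close to the identity and `δ`-close to each other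
(`‖τ(x,x′)v − τ′(x,x′)v‖ ≤ δ‖v‖`), then along a path with `|Γ|` bonds `‖R(Γ)v − R′(Γ)v‖ ≤ |Γ|·δ·(1 + ε)^{|Γ|}·‖v‖`
(`τw − τ′w′ = (τ − τ′)w + τ′(w − w′)` bond after bond). [cite: Balaban1985Averaging, (9) p.18; Balaban1985BackgroundPropagators, (3.65) p.403] -/
theorem norm_pathTr_cons_sub_pathTr_le {τ τ' : X → X → V →ₗ[ℝ] V} {ε δ : ℝ} (hε : 0 ≤ ε) (hδ : 0 ≤ δ)
    (hτ : ∀ x x' v, ‖τ x x' v - v‖ ≤ ε * ‖v‖) (hτ' : ∀ x x' v, ‖τ' x x' v - v‖ ≤ ε * ‖v‖)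
    (hττ' : ∀ x x' v, ‖τ x x' v - τ' x x' v‖ ≤ δ * ‖v‖) :
    ∀ (p : List X) (x : X) (v : V), ‖pathTr τ (x :: p) v - pathTr τ' (x :: p) v‖ ≤ p.length * δ * (1 + ε) ^ p.length * ‖v‖
  | [], x, v => by simp [B9Eq323Ker.pathTr_singleton]
  | x' :: rest, x, v => by
    have ih := norm_pathTr_cons_sub_pathTr_le hε hδ hτ hτ' hττ' rest x' v
    rw [B9Eq323Ker.pathTr_cons_cons, B9Eq323Ker.pathTr_cons_cons, LinearMap.comp_apply, LinearMap.comp_apply, List.length_cons,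
      pow_succ, Nat.cast_succ]
    set w := pathTr τ (x' :: rest) v with hw
    set w' := pathTr τ' (x' :: rest) v with hw'
    have hwn : ‖w‖ ≤ (1 + ε) ^ rest.length * ‖v‖ := norm_pathTr_cons_le hε hτ rest x' v
    have h1 : ‖τ' x x' (w - w')‖ ≤ (1 + ε) * ‖w - w'‖ := by
      calc ‖τ' x x' (w - w')‖ = ‖(τ' x x' (w - w') - (w - w')) + (w - w')‖ := by rw [sub_add_cancel]
        _ ≤ ‖τ' x x' (w - w') - (w - w')‖ + ‖w - w'‖ := norm_add_le _ _
        _ ≤ ε * ‖w - w'‖ + ‖w - w'‖ := by gcongr; exact hτ' x x' _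
        _ = (1 + ε) * ‖w - w'‖ := by ring
    have hpow : (1 : ℝ) ≤ (1 + ε) ^ rest.length := one_le_pow₀ (by linarith)
    have hn : (0 : ℝ) ≤ rest.length := Nat.cast_nonneg _
    calc ‖τ x x' w - τ' x x' w'‖ = ‖(τ x x' w - τ' x x' w) + τ' x x' (w - w')‖ := by rw [map_sub, sub_add_sub_cancel]
      _ ≤ ‖τ x x' w - τ' x x' w‖ + ‖τ' x x' (w - w')‖ := norm_add_le _ _
      _ ≤ δ * ‖w‖ + (1 + ε) * ‖w - w'‖ := add_le_add (hττ' x x' w) h1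
      _ ≤ δ * ((1 + ε) ^ rest.length * ‖v‖) + (1 + ε) * (rest.length * δ * (1 + ε) ^ rest.length * ‖v‖) := by gcongr
      _ = (1 + rest.length * (1 + ε)) * δ * (1 + ε) ^ rest.length * ‖v‖ := by ring
      _ ≤ ((rest.length + 1) * (1 + ε)) * δ * (1 + ε) ^ rest.length * ‖v‖ := by
          have hfac : 0 ≤ δ * (1 + ε) ^ rest.length * ‖v‖ := by positivity
          have hle : 1 + rest.length * (1 + ε) ≤ (rest.length + 1) * (1 + ε) := by nlinarith
          calc (1 + rest.length * (1 + ε)) * δ * (1 + ε) ^ rest.length * ‖v‖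
              = (1 + rest.length * (1 + ε)) * (δ * (1 + ε) ^ rest.length * ‖v‖) := by ring
            _ ≤ ((rest.length + 1) * (1 + ε)) * (δ * (1 + ε) ^ rest.length * ‖v‖) := mul_le_mul_of_nonneg_right hle hfac
            _ = ((rest.length + 1) * (1 + ε)) * δ * (1 + ε) ^ rest.length * ‖v‖ := by ring
      _ = (rest.length + 1) * δ * ((1 + ε) ^ rest.length * (1 + ε)) * ‖v‖ := by ring

end PathTransport
variable (L : ℕ) [NeZero L] (m : Fin d → ℕ)

/-! ## §2 Two-background (ρ′) for the concrete (3.19) -/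
section QprimeLip
variable {V : Type*} [NormedAddCommGroup V] [NormedSpace ℂ V]

omit [NeZero L] in
/-- Two step transporters of `B9Eq319QprimeTorus` inherit the mutual closeness of the bond transporters (both a bond transporter at the same bond,
or both the identity). [cite: Balaban1985BackgroundPropagators, (3.19) p.393] -/
theorem norm_stepTransport_sub_stepTransport_le (Rb Rb' : Bond d (fineP L m) → V →ₗ[ℂ] V) {δ : ℝ} (hδ : 0 ≤ δ)
    (hRR' : ∀ b v, ‖Rb b v - Rb' b v‖ ≤ δ * ‖v‖) (x x' : TSite d (fineP L m)) (v : V) :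
    ‖stepTransport L m (fun b => (Rb b).restrictScalars ℝ) x x' v - stepTransport L m (fun b => (Rb' b).restrictScalars ℝ) x x' v‖ ≤ δ * ‖v‖ := by
  unfold stepTransport
  split_ifs with h
  · exact hRR' _ v
  · rw [LinearMap.id_apply, sub_self, norm_zero]; positivity

omit [NeZero L] in
/-- The two-background modulus `ρ′₂(ε, δ) = d(L−1)·δ·(1 + ε)^{d(L−1)}` is `≥ 0`. [cite: Balaban1985BackgroundPropagators, p.403] -/
theorem rho₂_nonneg {ε δ : ℝ} (hε : 0 ≤ ε) (hδ : 0 ≤ δ) : 0 ≤ (d * (L - 1) : ℕ) * δ * (1 + ε) ^ (d * (L - 1)) := by positivity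

/-- **TWO-BACKGROUND (ρ′), POINTWISE BLOCK FORM**: for `ℂ`-linear bond transporter families `R`, `R′` both `ε`-close to the identity and `δ`-close
to each other, `‖(Q′(R)λ)(y) − (Q′(R′)λ)(y)‖ ≤ d(L−1)·δ·(1 + ε)^{d(L−1)}·L^{−d}·Σ_{x∈B(y)} ‖λ(x)‖` — each term of (3.19) is transported along a
contour of at most `d(L−1)` bonds (§1). [cite: Balaban1985BackgroundPropagators, (3.19) p.393, (3.65) p.403] -/
theorem norm_QprimeLin_sub_QprimeLin_apply_le (Rb Rb' : Bond d (fineP L m) → V →ₗ[ℂ] V) {ε δ : ℝ} (hε : 0 ≤ ε) (hδ : 0 ≤ δ)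
    (hR : ∀ b v, ‖Rb b v - v‖ ≤ ε * ‖v‖) (hR' : ∀ b v, ‖Rb' b v - v‖ ≤ ε * ‖v‖) (hRR' : ∀ b v, ‖Rb b v - Rb' b v‖ ≤ δ * ‖v‖)
    (l : TSite d (fineP L m) → V) (y : TSite d m) :
    ‖QprimeLin L m Rb l y - QprimeLin L m Rb' l y‖ ≤
      ((d * (L - 1) : ℕ) * δ * (1 + ε) ^ (d * (L - 1))) * (((L : ℝ) ^ d)⁻¹ * ∑ x ∈ B9Eq319QprimeTorus.blockOf L m y, ‖l x‖) := by
  have hw : 0 ≤ ((L : ℝ) ^ d)⁻¹ := by positivity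
  rw [QprimeLin_apply, QprimeLin_apply, Qprime, Qprime, avgQ, avgQ, ← Finset.sum_sub_distrib, Finset.mul_sum, Finset.mul_sum]
  refine (norm_sum_le _ _).trans (Finset.sum_le_sum fun x _ => ?_)
  rw [weight, ← smul_sub, norm_smul, norm_inv, norm_pow, Real.norm_natCast]
  have hstep := norm_stepTransport_sub_le L m Rb hε hR
  have hstep' := norm_stepTransport_sub_le L m Rb' hε hR'
  have hstep₂ := norm_stepTransport_sub_stepTransport_le L m Rb Rb' hδ hRR'
  have h1 := norm_pathTr_cons_sub_pathTr_le hε hδ hstep hstep' hstep₂ (contour L m x) (centre L m y) (l x)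
  have hlen : ((contour L m x).length : ℝ) ≤ ((d * (L - 1) : ℕ) : ℝ) := by exact_mod_cast length_contour_le L m x
  have h2 : ((contour L m x).length : ℝ) * δ * (1 + ε) ^ (contour L m x).length ≤ (d * (L - 1) : ℕ) * δ * (1 + ε) ^ (d * (L - 1)) := by
    have hp : (1 + ε) ^ (contour L m x).length ≤ (1 + ε) ^ (d * (L - 1)) := pow_le_pow_right₀ (by linarith) (length_contour_le L m x)
    have h0 : 0 ≤ ((contour L m x).length : ℝ) * δ := by positivity
    calc ((contour L m x).length : ℝ) * δ * (1 + ε) ^ (contour L m x).length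
        ≤ ((contour L m x).length : ℝ) * δ * (1 + ε) ^ (d * (L - 1)) := mul_le_mul_of_nonneg_left hp h0
      _ ≤ (d * (L - 1) : ℕ) * δ * (1 + ε) ^ (d * (L - 1)) := by gcongr
  calc ((L : ℝ) ^ d)⁻¹ * ‖pathTr (stepTransport L m fun b => (Rb b).restrictScalars ℝ) (centre L m y :: contour L m x) (l x)
        - pathTr (stepTransport L m fun b => (Rb' b).restrictScalars ℝ) (centre L m y :: contour L m x) (l x)‖
      ≤ ((L : ℝ) ^ d)⁻¹ * (((d * (L - 1) : ℕ) * δ * (1 + ε) ^ (d * (L - 1))) * ‖l x‖) := by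
        refine mul_le_mul_of_nonneg_left (h1.trans ?_) hw
        exact mul_le_mul_of_nonneg_right h2 (norm_nonneg _)
    _ = ((d * (L - 1) : ℕ) * δ * (1 + ε) ^ (d * (L - 1))) * (((L : ℝ) ^ d)⁻¹ * ‖l x‖) := by ring

/-- **TWO-BACKGROUND (ρ′), SUP FORM — `Q′` IS LIPSCHITZ IN THE BACKGROUND**: `‖Q′(R)λ − Q′(R′)λ‖_∞ ≤ d(L−1)·δ·(1 + ε)^{d(L−1)}·‖λ‖_∞`
(p. 403: the averaging operators at nearby backgrounds differ by the perturbation `F′₂`; here the explicit finite-lattice modulus).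
[cite: Balaban1985BackgroundPropagators, (3.19) p.393, (3.65) p.403, (3.79)–(3.81) p.406] -/
theorem norm_QprimeLin_sub_QprimeLin_le (Rb Rb' : Bond d (fineP L m) → V →ₗ[ℂ] V) {ε δ : ℝ} (hε : 0 ≤ ε) (hδ : 0 ≤ δ)
    (hR : ∀ b v, ‖Rb b v - v‖ ≤ ε * ‖v‖) (hR' : ∀ b v, ‖Rb' b v - v‖ ≤ ε * ‖v‖) (hRR' : ∀ b v, ‖Rb b v - Rb' b v‖ ≤ δ * ‖v‖)
    (l : TSite d (fineP L m) → V) :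
    ‖QprimeLin L m Rb l - QprimeLin L m Rb' l‖ ≤ ((d * (L - 1) : ℕ) * δ * (1 + ε) ^ (d * (L - 1))) * ‖l‖ := by
  have hρ := rho₂_nonneg L (d := d) hε hδ
  refine (pi_norm_le_iff_of_nonneg (by positivity)).2 fun y => ?_
  rw [Pi.sub_apply]
  exact (norm_QprimeLin_sub_QprimeLin_apply_le L m Rb Rb' hε hδ hR hR' hRR' l y).trans
    (mul_le_mul_of_nonneg_left (blockMean_norm_le L m l y) hρ)

/-- **TWO-BACKGROUND (ρ′), HILBERT CURRENCY**: `Σ_y ‖(Q′(R)λ − Q′(R′)λ)(y)‖² ≤ ρ′₂(ε,δ)²·L^{−d}·Σ_x ‖λ(x)‖²` (block form + the (ρ′) file's block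
Jensen and block partition). [cite: Balaban1985BackgroundPropagators, (3.19) p.393, (3.11) p.392, p.403] -/
theorem sum_norm_sq_QprimeLin_sub_QprimeLin_le (Rb Rb' : Bond d (fineP L m) → V →ₗ[ℂ] V) {ε δ : ℝ} (hε : 0 ≤ ε) (hδ : 0 ≤ δ)
    (hR : ∀ b v, ‖Rb b v - v‖ ≤ ε * ‖v‖) (hR' : ∀ b v, ‖Rb' b v - v‖ ≤ ε * ‖v‖) (hRR' : ∀ b v, ‖Rb b v - Rb' b v‖ ≤ δ * ‖v‖)
    (l : TSite d (fineP L m) → V) :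
    ∑ y, ‖QprimeLin L m Rb l y - QprimeLin L m Rb' l y‖ ^ 2 ≤
      ((d * (L - 1) : ℕ) * δ * (1 + ε) ^ (d * (L - 1))) ^ 2 * (((L : ℝ) ^ d)⁻¹ * ∑ x, ‖l x‖ ^ 2) := by
  have hρ := rho₂_nonneg L (d := d) hε hδ
  calc ∑ y, ‖QprimeLin L m Rb l y - QprimeLin L m Rb' l y‖ ^ 2
      ≤ ∑ y, (((d * (L - 1) : ℕ) * δ * (1 + ε) ^ (d * (L - 1))) * (((L : ℝ) ^ d)⁻¹ * ∑ x ∈ B9Eq319QprimeTorus.blockOf L m y, ‖l x‖)) ^ 2 :=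
        Finset.sum_le_sum fun y _ => pow_le_pow_left₀ (norm_nonneg _) (norm_QprimeLin_sub_QprimeLin_apply_le L m Rb Rb' hε hδ hR hR' hRR' l y) 2
    _ ≤ ∑ y, ((d * (L - 1) : ℕ) * δ * (1 + ε) ^ (d * (L - 1))) ^ 2 * (((L : ℝ) ^ d)⁻¹ * ∑ x ∈ B9Eq319QprimeTorus.blockOf L m y, ‖l x‖ ^ 2) :=
        Finset.sum_le_sum fun y _ => by
          rw [mul_pow]; exact mul_le_mul_of_nonneg_left (blockMean_norm_sq_le L m l y) (sq_nonneg _)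
    _ = ((d * (L - 1) : ℕ) * δ * (1 + ε) ^ (d * (L - 1))) ^ 2 * (((L : ℝ) ^ d)⁻¹ * ∑ x, ‖l x‖ ^ 2) := by
        rw [← Finset.mul_sum, ← Finset.mul_sum, sum_blockOf_sum]

end QprimeLip

/-! ## §3 Two-background (ρ′) on the owner's `QprimeW` (the `L²` carrier of the NE9 chain) -/
section QprimeWLip
variable {𝔸 : Type*} [Ring 𝔸] [Algebra ℂ 𝔸] {W : Type*} [NormedAddCommGroup W] [InnerProductSpace ℂ W] (φ : W ≃ₗ[ℂ] 𝔸) {c₀ : ℝ}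
  (U U' : Bond d (fineP L m) → 𝔸ˣ) {ε δ : ℝ} (hε : 0 ≤ ε) (hδ : 0 ≤ δ)
  (hR : ∀ b w, ‖adTransportW φ U b w - w‖ ≤ ε * ‖w‖) (hR' : ∀ b w, ‖adTransportW φ U' b w - w‖ ≤ ε * ‖w‖)
  (hRR' : ∀ b w, ‖adTransportW φ U b w - adTransportW φ U' b w‖ ≤ δ * ‖w‖)

include hε hδ hR hR' hRR' in
/-- **TWO-BACKGROUND (ρ′) ON THE `L²` CARRIER, SUP FORM**: under the fibre letters `‖R(U(b))w − w‖, ‖R(U′(b))w − w‖ ≤ ε‖w‖` and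
`‖R(U(b))w − R(U′(b))w‖ ≤ δ‖w‖`, `‖Q′(U)λ − Q′(U′)λ‖_∞ ≤ d(L−1)·δ·(1+ε)^{d(L−1)}·‖λ‖_∞` (`‖λ‖_∞` the sup norm of the underlying `W`-valued function).
[cite: Balaban1985BackgroundPropagators, (3.19) p.393, (3.65) p.403, (3.79)–(3.81) p.406] -/
theorem norm_QprimeW_sub_QprimeW_le (lam : SiteL2K ℂ d (fineP L m) c₀ W) :
    ‖QprimeW L m φ U (c₀ := c₀) lam - QprimeW L m φ U' (c₀ := c₀) lam‖ ≤
      ((d * (L - 1) : ℕ) * δ * (1 + ε) ^ (d * (L - 1))) * ‖WL2.linearEquiv ℂ ℂ (fun _ : TSite d (fineP L m) => c₀) lam‖ := by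
  rw [QprimeW, QprimeW, LinearMap.comp_apply, LinearMap.comp_apply]
  exact norm_QprimeLin_sub_QprimeLin_le L m (adTransportW φ U) (adTransportW φ U') hε hδ hR hR' hRR' _

variable [Fact (0 < c₀)]

include hε hδ hR hR' hRR' in
/-- **… WITH THE `L²` NORM (3.11) ON THE RIGHT**: `‖Q′(U)λ − Q′(U′)λ‖_∞ ≤ ρ′₂·c₀^{−1/2}·‖λ‖_{L²}`. [cite: Balaban1985BackgroundPropagators, (3.19) p.393, (3.11) p.392, p.403] -/
theorem norm_QprimeW_sub_QprimeW_le_L2 (lam : SiteL2K ℂ d (fineP L m) c₀ W) :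
    ‖QprimeW L m φ U (c₀ := c₀) lam - QprimeW L m φ U' (c₀ := c₀) lam‖ ≤
      ((d * (L - 1) : ℕ) * δ * (1 + ε) ^ (d * (L - 1))) * ((Real.sqrt c₀)⁻¹ * ‖lam‖) :=
  (norm_QprimeW_sub_QprimeW_le L m φ U U' hε hδ hR hR' hRR' lam).trans
    (mul_le_mul_of_nonneg_left (pi_norm_le_WL2_norm L m lam) (rho₂_nonneg L (d := d) hε hδ))

include hε hδ hR hR' hRR' in
/-- **TWO-BACKGROUND (ρ′) ON THE `L²` CARRIER, HILBERT CURRENCY**: `Σ_y ‖(Q′(U)λ − Q′(U′)λ)(y)‖² ≤ ρ′₂²·(L^d·c₀)⁻¹·‖λ‖²_{L²}`.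
[cite: Balaban1985BackgroundPropagators, (3.19) p.393, (3.11) p.392, p.403] -/
theorem sum_norm_sq_QprimeW_sub_QprimeW_le (lam : SiteL2K ℂ d (fineP L m) c₀ W) :
    ∑ y, ‖QprimeW L m φ U (c₀ := c₀) lam y - QprimeW L m φ U' (c₀ := c₀) lam y‖ ^ 2 ≤
      ((d * (L - 1) : ℕ) * δ * (1 + ε) ^ (d * (L - 1))) ^ 2 * (((L : ℝ) ^ d * c₀)⁻¹ * ‖lam‖ ^ 2) := by
  have hc : 0 < c₀ := Fact.out
  have hn : ‖lam‖ ^ 2 = c₀ * ∑ x, ‖WL2.linearEquiv ℂ ℂ (fun _ : TSite d (fineP L m) => c₀) lam x‖ ^ 2 := by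
    rw [WL2.norm_sq, Finset.mul_sum]; rfl
  have hsum : ((L : ℝ) ^ d * c₀)⁻¹ * ‖lam‖ ^ 2 = ((L : ℝ) ^ d)⁻¹ * ∑ x, ‖WL2.linearEquiv ℂ ℂ (fun _ : TSite d (fineP L m) => c₀) lam x‖ ^ 2 := by
    rw [hn, mul_inv, mul_assoc, inv_mul_cancel_left₀ hc.ne']
  rw [hsum, QprimeW, QprimeW]
  exact sum_norm_sq_QprimeLin_sub_QprimeLin_le L m (adTransportW φ U) (adTransportW φ U') hε hδ hR hR' hRR' _

end QprimeWLip

/-! ## §4 The printed instance `R(U(b))X = U(b)XU(b)⁻¹` at two `U1`-valued backgrounds -/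
section Printed
variable {𝔸 : Type*} [NormedRing 𝔸] [NormedAlgebra ℂ 𝔸] [NormOneClass 𝔸]

omit [NormedAlgebra ℂ 𝔸] in
/-- Conjugations by two units of the unit-ball group `U1 𝔸` differ by at most twice their distance:
`‖UXU⁻¹ − U′XU′⁻¹‖ ≤ 2‖U − U′‖·‖X‖` (`= (U − U′)XU⁻¹ + U′X(U⁻¹ − U′⁻¹)`, `U⁻¹ − U′⁻¹ = U⁻¹(U′ − U)U′⁻¹`, all factors of norm `≤ 1`).
[cite: Balaban1985BackgroundPropagators, p.390; Balaban1985Averaging, (9) p.18] -/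
theorem norm_conj_sub_conj_le_of_mem_U1 {U U' : 𝔸ˣ} (hU1 : U ∈ B7Prop1Explicit.U1 𝔸) (hU1' : U' ∈ B7Prop1Explicit.U1 𝔸) (X : 𝔸) :
    ‖(U : 𝔸) * X * ((U⁻¹ : 𝔸ˣ) : 𝔸) - (U' : 𝔸) * X * ((U'⁻¹ : 𝔸ˣ) : 𝔸)‖ ≤ 2 * ‖(U : 𝔸) - (U' : 𝔸)‖ * ‖X‖ := by
  have hUi : ‖((U⁻¹ : 𝔸ˣ) : 𝔸)‖ ≤ 1 := (B7Prop1Explicit.mem_U1.1 hU1).2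
  have hU'n : ‖((U' : 𝔸ˣ) : 𝔸)‖ ≤ 1 := (B7Prop1Explicit.mem_U1.1 hU1').1
  have hU'i : ‖((U'⁻¹ : 𝔸ˣ) : 𝔸)‖ ≤ 1 := (B7Prop1Explicit.mem_U1.1 hU1').2
  have hinv : ((U⁻¹ : 𝔸ˣ) : 𝔸) - ((U'⁻¹ : 𝔸ˣ) : 𝔸) = ((U⁻¹ : 𝔸ˣ) : 𝔸) * ((U' : 𝔸) - (U : 𝔸)) * ((U'⁻¹ : 𝔸ˣ) : 𝔸) := by
    rw [mul_sub, sub_mul, mul_assoc, Units.mul_inv, mul_one, Units.inv_mul, one_mul]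
  have hinvn : ‖((U⁻¹ : 𝔸ˣ) : 𝔸) - ((U'⁻¹ : 𝔸ˣ) : 𝔸)‖ ≤ ‖(U : 𝔸) - (U' : 𝔸)‖ := by
    rw [hinv]
    calc _ ≤ ‖((U⁻¹ : 𝔸ˣ) : 𝔸)‖ * ‖(U' : 𝔸) - (U : 𝔸)‖ * ‖((U'⁻¹ : 𝔸ˣ) : 𝔸)‖ :=
          (norm_mul_le _ _).trans (mul_le_mul_of_nonneg_right (norm_mul_le _ _) (norm_nonneg _))
      _ ≤ 1 * ‖(U' : 𝔸) - (U : 𝔸)‖ * 1 := by gcongr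
      _ = ‖(U : 𝔸) - (U' : 𝔸)‖ := by rw [one_mul, mul_one, norm_sub_rev]
  have hsplit : (U : 𝔸) * X * ((U⁻¹ : 𝔸ˣ) : 𝔸) - (U' : 𝔸) * X * ((U'⁻¹ : 𝔸ˣ) : 𝔸) =
      ((U : 𝔸) - (U' : 𝔸)) * X * ((U⁻¹ : 𝔸ˣ) : 𝔸) + (U' : 𝔸) * X * (((U⁻¹ : 𝔸ˣ) : 𝔸) - ((U'⁻¹ : 𝔸ˣ) : 𝔸)) := by
    noncomm_ring
  rw [hsplit]
  calc ‖((U : 𝔸) - (U' : 𝔸)) * X * ((U⁻¹ : 𝔸ˣ) : 𝔸) + (U' : 𝔸) * X * (((U⁻¹ : 𝔸ˣ) : 𝔸) - ((U'⁻¹ : 𝔸ˣ) : 𝔸))‖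
      ≤ ‖((U : 𝔸) - (U' : 𝔸)) * X * ((U⁻¹ : 𝔸ˣ) : 𝔸)‖ + ‖(U' : 𝔸) * X * (((U⁻¹ : 𝔸ˣ) : 𝔸) - ((U'⁻¹ : 𝔸ˣ) : 𝔸))‖ := norm_add_le _ _
    _ ≤ ‖(U : 𝔸) - (U' : 𝔸)‖ * ‖X‖ * ‖((U⁻¹ : 𝔸ˣ) : 𝔸)‖ + ‖((U' : 𝔸ˣ) : 𝔸)‖ * ‖X‖ * ‖((U⁻¹ : 𝔸ˣ) : 𝔸) - ((U'⁻¹ : 𝔸ˣ) : 𝔸)‖ :=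
        add_le_add ((norm_mul_le _ _).trans (mul_le_mul_of_nonneg_right (norm_mul_le _ _) (norm_nonneg _)))
          ((norm_mul_le _ _).trans (mul_le_mul_of_nonneg_right (norm_mul_le _ _) (norm_nonneg _)))
    _ ≤ ‖(U : 𝔸) - (U' : 𝔸)‖ * ‖X‖ * 1 + 1 * ‖X‖ * ‖(U : 𝔸) - (U' : 𝔸)‖ := by gcongr
    _ = 2 * ‖(U : 𝔸) - (U' : 𝔸)‖ * ‖X‖ := by ring

omit [NeZero L] in
/-- The printed transporters at two `U1`-valued backgrounds with `‖U(b) − U′(b)‖ ≤ δ_U` are `2δ_U`-close to each other.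
[cite: Balaban1985BackgroundPropagators, p.390] -/
theorem norm_adTransport_sub_adTransport_le (U U' : Bond d (fineP L m) → 𝔸ˣ) (hU1 : ∀ b, U b ∈ B7Prop1Explicit.U1 𝔸)
    (hU1' : ∀ b, U' b ∈ B7Prop1Explicit.U1 𝔸) {δU : ℝ} (hUU' : ∀ b, ‖(U b : 𝔸) - (U' b : 𝔸)‖ ≤ δU) (b : Bond d (fineP L m)) (X : 𝔸) :
    ‖adTransport (𝕜 := ℂ) U b X - adTransport (𝕜 := ℂ) U' b X‖ ≤ 2 * δU * ‖X‖ := by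
  rw [adTransport_apply, adTransport_apply]
  exact (norm_conj_sub_conj_le_of_mem_U1 (hU1 b) (hU1' b) X).trans
    (mul_le_mul_of_nonneg_right (mul_le_mul_of_nonneg_left (hUU' b) (by norm_num)) (norm_nonneg _))

/-- **TWO-BACKGROUND (ρ′) FOR THE PRINTED `Q′(U)` AT `U1`-VALUED BACKGROUNDS** (the chain's `hU1` letter): `‖U(b) − 1‖, ‖U′(b) − 1‖ ≤ ε_U` and
`‖U(b) − U′(b)‖ ≤ δ_U` for all bonds ⇒ `‖Q′(U)λ − Q′(U′)λ‖_∞ ≤ d(L−1)·(2δ_U)·(1 + 2ε_U)^{d(L−1)}·‖λ‖_∞` (the (ρ′) file's `norm_conj_sub_le_of_mem_U1`: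
each transporter is `2ε_U`-close to the identity). [cite: Balaban1985BackgroundPropagators, (3.19) p.393, (3.65) p.403] -/
theorem norm_QprimeAd_sub_QprimeAd_le_of_mem_U1 (U U' : Bond d (fineP L m) → 𝔸ˣ) (hU1 : ∀ b, U b ∈ B7Prop1Explicit.U1 𝔸)
    (hU1' : ∀ b, U' b ∈ B7Prop1Explicit.U1 𝔸) {εU δU : ℝ} (hεU : 0 ≤ εU) (hδU : 0 ≤ δU)
    (hU : ∀ b, ‖(U b : 𝔸) - 1‖ ≤ εU) (hU' : ∀ b, ‖(U' b : 𝔸) - 1‖ ≤ εU) (hUU' : ∀ b, ‖(U b : 𝔸) - (U' b : 𝔸)‖ ≤ δU)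
    (l : TSite d (fineP L m) → 𝔸) :
    ‖QprimeAd L m U l - QprimeAd L m U' l‖ ≤ ((d * (L - 1) : ℕ) * (2 * δU) * (1 + 2 * εU) ^ (d * (L - 1))) * ‖l‖ := by
  rw [QprimeAd, QprimeAd]
  refine norm_QprimeLin_sub_QprimeLin_le L m (adTransport (𝕜 := ℂ) U) (adTransport (𝕜 := ℂ) U') (by positivity) (by positivity)
    (fun b X => ?_) (fun b X => ?_) (norm_adTransport_sub_adTransport_le L m U U' hU1 hU1' hUU') l
  · rw [adTransport_apply]; exact B9Eq319QprimeLipschitz.norm_conj_sub_le_of_mem_U1 (hU1 b) (hU b) X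
  · rw [adTransport_apply]; exact B9Eq319QprimeLipschitz.norm_conj_sub_le_of_mem_U1 (hU1' b) (hU' b) X

end Printed
end Literature.MathematicalPhysics.QuantumFieldTheory.Balaban1983to89.B9Eq319QprimeLipschitzTwoBackgrounds
end
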